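import Summits.KontsevichZagierPeriods.KontsevichZagierPeriods.Theorems.HurwitzMicroSectorsNormalFormPrincipleL2W3Carriers
import Summits.KontsevichZagierPeriods.KontsevichZagierPeriods.Theorems.HurwitzMicroSectorsNormalFormPrincipleL2W3ExistsChartTargets
import Summits.KontsevichZagierPeriods.KontsevichZagierPeriods.Theorems.HurwitzMicroSectorsNormalFormPrincipleM3EbdBoxSubSimplex
import Summits.KontsevichZagierPeriods.KontsevichZagierPeriods.Theorems.HurwitzMicroSectorsNormalFormPrincipleL2W3RelationsDilation
import Summits.KontsevichZagierPeriods.KontsevichZagierPeriods.Theorems.HurwitzMicroSectorsNormalFormPrincipleL2W3RelationsMoebiusOne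
import Summits.KontsevichZagierPeriods.KontsevichZagierPeriods.Theorems.HurwitzMicroSectorsNormalFormPrincipleL2W3RelationsReflection
import Summits.KontsevichZagierPeriods.KontsevichZagierPeriods.Theorems.HurwitzMicroSectorsNormalFormPrincipleL2W3BoxSubPrism
import Summits.KontsevichZagierPeriods.KontsevichZagierPeriods.Theorems.HurwitzMicroSectorsNormalFormPrincipleL2W3RelationShuffle

/-!
# `NormalFormPrinciple` (stmt-KontsevichZagierPeriods-3869), line `SketchIdeator1` —
# M3 kernel capstone: the half-point reduction
# `2[1/((1+x)(1+xyz))] − 2[ζ(3) box] + [ζ(2)log2 box] ∈ KZ.relations`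

Pure proof file (registered sub-goal `m3k_reduce_halfPoint` of the M3 kernel capstone, lead seat
c9; `--supports` the crux). The capstone reduces every dimension-three box family of the six
`m3-equal-value-instances` to `α•[Z] + β•[Q]` modulo `KZ.relations`, where `Z` is any
representation of `[(0,1)³, 1/(1−xyz)]` (value `ζ(3)`) and `Q` any representation of the product
box `[(0,1)³, 1/((1−xy)(1+z))]` (value `ζ(2)·log 2`). The ONE word-level certificate needed beyond
the six landed equivalences is supplied here: for any box representation `N7` of
`1/((1+x)(1+xyz))` (value `ζ(3) − ½ζ(2)log 2`),

  `2•[N7] − 2•[Z] + [Q] ∈ KZ.relations`.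

Chain of moves (letters `a(u) = 1/u`, `b(u) = 1/(1−u)`, `c(u) = 1/(1+u)`, words on the decreasing
open simplex `Δ`, the prism `P = {1 > t₀ > t₁ > 0} × {0 < t₂ < 1}`): the simplex chart
`(x, xy, xyz)` gives `[N7] = [aac] − [cac]` and `[Z] = [aab]`; the prism chart `(x, xy, z)` gives
`[Q] = [P, ab ⊗ c]`; and the integer certificate

  `2[aac] − 2[cac] − 2[aab] + [P, ab ⊗ c] = −rel1 + rel2 + 2rel3 + 2rel4 − 3rel5 + S1 − relS`

over the landed relation packages (dilation `rel1`, `rel2`; Möbius `rel3`, `rel4`; reflection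
`rel5`; the shuffle `S1 : [P, ab ⊗ c] = [abc] + [acb] + [cab]` and the shuffle relation
`relS : 4[acc] + 2[cac] = [abc] + [acb] + [cab]`). Bookkeeping only; no independence input.
References: M. Kontsevich, D. Zagier, *Periods* (2001), §1.1–1.2 (rules (1), (2)).
No definitions are introduced.
-/

noncomputable section

open MeasureTheory Set
open Literature.NumberTheory.Transcendental Literature.NumberTheory.Transcendental.KZ
open Literature.ModelTheory.ExponentialFields (IsSemialgebraic)
open Summit.KontsevichZagierPeriods.HyperbolicBloch.OffTetraSectorKernel
  (aff_orbit_of_sub_sum_zsmul_mem_relations)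

namespace Summit.KontsevichZagierPeriods.HurwitzMicroSectors.NormalFormPrinciple.PiBox.M3

/-- **Stub (`m3k_reduce_halfPoint`; registered sub-goal of stmt-KontsevichZagierPeriods-3869,
line `SketchIdeator1`, layer `M3` kernel capstone).** For any box representation `N7` of
`1/((1+x)(1+xyz))`, any box representation `Z` of `1/(1−xyz)` and any box representation `Q` of
`1/((1−xy)(1+z))`: `2•[N7] − 2•[Z] + [Q] ∈ KZ.relations` (values:
`2(ζ(3) − ½ζ(2)log 2) − 2ζ(3) + ζ(2)log 2 = 0`, obtained inside the calculus: two simplex charts,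
one prism chart, and the certificate `2[aac] − 2[cac] − 2[aab] + [P, ab ⊗ c] =
−rel1 + rel2 + 2rel3 + 2rel4 − 3rel5 + S1 − relS` over the landed relation packages).
[cite: KontsevichZagier2001, §1.2 rules (1), (2)] -/
theorem m3k_reduce_halfPoint :
    ∀ (N7 Z Q : IntegralRep 3),
      N7.domain = {x | ∀ i, x i ∈ Set.Ioo (0:ℝ) 1} →
      EqOn N7.integrand (fun x => 1 / ((1 + x 0) * (1 + x 0 * x 1 * x 2))) N7.domain →
      Z.domain = {x | ∀ i, x i ∈ Set.Ioo (0:ℝ) 1} → EqOn Z.integrand (fun x => 1 / (1 - x 0 * x 1 * x 2)) Z.domain →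
      Q.domain = {x | ∀ i, x i ∈ Set.Ioo (0:ℝ) 1} → EqOn Q.integrand (fun x => 1 / ((1 - x 0 * x 1) * (1 + x 2))) Q.domain →
      (2:ℤ) • of N7 - (2:ℤ) • of Z + of Q ∈ relations := by
  intro N7 Z Q hN7d hN7i hZd hZi hQd hQi
  -- (1) the word carriers on `Δ` and the chart target `G5 = [Δ, 1/(t₀(1+t₀)t₁(1+t₂))]`
  obtain ⟨AAB, ABB, AAC, ACC, ABC, ACB, CBB, CBC, CCB, CCC, CAB, CAC, -, -, -, -,
    ⟨hAABd, hAABi⟩, ⟨hABBd, hABBi⟩, ⟨hAACd, hAACi⟩, ⟨hACCd, hACCi⟩, ⟨hABCd, hABCi⟩,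
    ⟨hACBd, hACBi⟩, ⟨hCBBd, hCBBi⟩, ⟨hCBCd, hCBCi⟩, ⟨hCCBd, hCCBi⟩, ⟨hCCCd, hCCCi⟩,
    ⟨hCABd, hCABi⟩, ⟨hCACd, hCACi⟩, -, -, -, -⟩ := l2w3_carriers
  obtain ⟨-, -, -, -, ⟨G5, hG5d, hG5i⟩, -⟩ := l2w3_exists_chartTargets
  -- (2) `[N7] = [G5]` by the simplex chart `(x, xy, xyz)`; `[G5] = [aac] − [cac]` by rule (1b)
  have eN : of N7 - of G5 ∈ relations := by
    refine ebd_box_sub_simplex (fun t => 1 / (t 0 * (1 + t 0) * t 1 * (1 + t 2))) N7 G5 hN7d hG5d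
      (hG5i ▸ fun _ _ => rfl) fun x hx => ?_
    have hx' : ∀ i, x i ∈ Set.Ioo (0:ℝ) 1 := by rw [hN7d] at hx; exact hx
    have h0 : x 0 ≠ 0 := (hx' 0).1.ne'
    have h1 : x 1 ≠ 0 := (hx' 1).1.ne'
    have h012 : 1 + x 0 * x 1 * x 2 ≠ 0 := by
      nlinarith [(hx' 0).1, (hx' 1).1, (hx' 2).1, mul_pos (hx' 0).1 (hx' 1).1]
    have hp0 : 1 + x 0 ≠ 0 := by linarith [(hx' 0).1]
    rw [hN7i hx]
    simp only [Matrix.cons_val_zero, Matrix.cons_val_one, Matrix.cons_val_two, Matrix.head_cons,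
      Matrix.tail_cons]
    field_simp
  have eN' : of G5 - ((1:ℤ) • of AAC + (-1:ℤ) • of CAC) ∈ relations := by
    have h := aff_orbit_of_sub_sum_zsmul_mem_relations (Finset.univ : Finset (Fin 2))
      ![AAC, CAC] ![1, -1] G5 (fun i _ => by
        fin_cases i
        · exact hAACd.trans hG5d.symm
        · exact hCACd.trans hG5d.symm) fun t ht => ?_
    · simpa [Fin.sum_univ_two, add_assoc] using h
    have hf := l2v_simplex_facts (hG5d ▸ ht)
    simp only [Fin.sum_univ_two, Matrix.cons_val_zero, Matrix.cons_val_one, hG5i, hAACi, hCACi]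
    have h0 : t 0 ≠ 0 := hf.1.ne'
    have h0b : 1 + t 0 ≠ 0 := by linarith [hf.1]
    have h1 : t 1 ≠ 0 := hf.2.2.1.ne'
    have h2b : 1 + t 2 ≠ 0 := by linarith [hf.2.2.2.2.1]
    push_cast
    field_simp
    ring
  -- (3) `[Z] = [aab]` by the simplex chart: `1/(1−xyz) = a(x)·a(xy)·b(xyz)·(x²y)`
  have eZ : of Z - of AAB ∈ relations := by
    refine ebd_box_sub_simplex (fun t => 1 / t 0 * 1 / t 1 * (1 / (1 - t 2))) Z AAB hZd hAABd
      (hAABi ▸ fun _ _ => rfl) fun x hx => ?_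
    have hx' : ∀ i, x i ∈ Set.Ioo (0:ℝ) 1 := by rw [hZd] at hx; exact hx
    have h0 : x 0 ≠ 0 := (hx' 0).1.ne'
    have h1 : x 1 ≠ 0 := (hx' 1).1.ne'
    have h012m : 1 - x 0 * x 1 * x 2 ≠ 0 := by
      have := mul_lt_one_of_nonneg_of_lt_one_left (mul_pos (hx' 0).1 (hx' 1).1).le
        (mul_lt_one_of_nonneg_of_lt_one_left (hx' 0).1.le (hx' 0).2 (hx' 1).2.le) (hx' 2).2.le
      exact (sub_pos.2 this).ne'
    rw [hZi hx]
    simp only [Matrix.cons_val_zero, Matrix.cons_val_one, Matrix.cons_val_two, Matrix.head_cons,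
      Matrix.tail_cons]
    field_simp
  -- (4) `[Q] = [P, ab ⊗ c]` by the prism chart `(x, xy, z)`; the prism carriers (from `3•Q`)
  obtain ⟨hprism, hexP⟩ := l2w3_box_sub_prism
  obtain ⟨⟨PABC, hPABCd, hPABCi⟩, ⟨PACC, hPACCd, hPACCi⟩⟩ :=
    hexP (Q.constMul ((3:ℕ) : ℝ) (isAlgebraic_nat 3))
      (by rw [IntegralRep.domain_constMul]; exact hQd) fun x hx => by
        rw [IntegralRep.domain_constMul] at hx
        simp only [IntegralRep.integrand_constMul, hQi hx]
        push_cast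
        ring
  have eQ : of Q - of PABC ∈ relations := by
    refine hprism (fun t => 1 / t 0 * (1 / (1 - t 1)) * (1 / (1 + t 2))) Q PABC hQd hPABCd
      (hPABCi ▸ fun _ _ => rfl) fun x hx => ?_
    have hx' : ∀ i, x i ∈ Set.Ioo (0:ℝ) 1 := by rw [hQd] at hx; exact hx
    have h0 : x 0 ≠ 0 := (hx' 0).1.ne'
    have h01 : 1 - x 0 * x 1 ≠ 0 :=
      (sub_pos.2 (mul_lt_one_of_nonneg_of_lt_one_left (hx' 0).1.le (hx' 0).2 (hx' 1).2.le)).ne'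
    have h2 : 1 + x 2 ≠ 0 := by linarith [(hx' 2).1]
    rw [hQi hx]
    simp only [Matrix.cons_val_zero, Matrix.cons_val_one, Matrix.cons_val_two, Matrix.head_cons,
      Matrix.tail_cons]
    field_simp
  -- (5) the landed relation packages
  have rel1 : (3:ℤ) • of AAB - (4:ℤ) • of AAC ∈ relations :=
    l2w3_relations_dilation.1 AAB hAABd hAABi AAC hAACd hAACi
  have rel2 : of ABB - (2:ℤ) • of ABC - (2:ℤ) • of ACB + (2:ℤ) • of ACC ∈ relations :=
    l2w3_relations_dilation.2 ABB hABBd hABBi ABC hABCd hABCi ACB hACBd hACBi ACC hACCd hACCi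
  have rel3 : of CBB + of CBC + of CCB + of CCC - of AAC ∈ relations :=
    l2w3_relations_moebius_one.1 AAC hAACd hAACi CBB hCBBd hCBBi CBC hCBCd hCBCi CCB hCCBd hCCBi
      CCC hCCCd hCCCi
  have rel4 : of ABB + of ABC + of ACB + of ACC - of CBB - of CBC - of CCB - of CCC - of AAB ∈
      relations :=
    l2w3_relations_moebius_one.2 AAB hAABd hAABi ABB hABBd hABBi ABC hABCd hABCi ACB hACBd hACBi
      ACC hACCd hACCi CBB hCBBd hCBBi CBC hCBCd hCBCi CCB hCCBd hCCBi CCC hCCCd hCCCi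
  have rel5 : of ABB - of AAB ∈ relations :=
    l2w3_relations_reflection.1 AAB hAABd hAABi ABB hABBd hABBi
  obtain ⟨shuf, relS⟩ := l2w3_relation_shuffle PABC PACC ABC ACB CAB ACC CAC hPABCd hPABCi
    hPACCd hPACCi hABCd hABCi hACBd hACBi hCABd hCABi hACCd hACCi hCACd hCACi
  -- (6) the integer certificate
  --     `2[aac] − 2[cac] − 2[aab] + [P, ab ⊗ c] = −rel1 + rel2 + 2rel3 + 2rel4 − 3rel5 + S1 − relS`
  have key : (2:ℤ) • ((1:ℤ) • of AAC + (-1:ℤ) • of CAC) - (2:ℤ) • of AAB + of PABC =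
      -((3:ℤ) • of AAB - (4:ℤ) • of AAC)
      + (of ABB - (2:ℤ) • of ABC - (2:ℤ) • of ACB + (2:ℤ) • of ACC)
      + (2:ℤ) • (of CBB + of CBC + of CCB + of CCC - of AAC)
      + (2:ℤ) • (of ABB + of ABC + of ACB + of ACC - of CBB - of CBC - of CCB - of CCC - of AAB)
      - (3:ℤ) • (of ABB - of AAB)
      + (of PABC - of ABC - of ACB - of CAB)
      - ((4:ℤ) • of ACC + (2:ℤ) • of CAC - of ABC - of ACB - of CAB) := by
    abel
  have hmid :
      (2:ℤ) • ((1:ℤ) • of AAC + (-1:ℤ) • of CAC) - (2:ℤ) • of AAB + of PABC ∈ relations := by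
    rw [key]
    exact relations.sub_mem (relations.add_mem (relations.sub_mem (relations.add_mem
      (relations.add_mem (relations.add_mem (relations.neg_mem rel1) rel2)
      (relations.zsmul_mem rel3 2)) (relations.zsmul_mem rel4 2)) (relations.zsmul_mem rel5 3))
      shuf) relS
  -- (7) total
  have e : (2:ℤ) • of N7 - (2:ℤ) • of Z + of Q =
      (2:ℤ) • (of N7 - of G5) + (2:ℤ) • (of G5 - ((1:ℤ) • of AAC + (-1:ℤ) • of CAC))
      + ((2:ℤ) • ((1:ℤ) • of AAC + (-1:ℤ) • of CAC) - (2:ℤ) • of AAB + of PABC)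
      - (2:ℤ) • (of Z - of AAB) + (of Q - of PABC) := by
    abel
  rw [e]
  exact relations.add_mem (relations.sub_mem (relations.add_mem (relations.add_mem
    (relations.zsmul_mem eN 2) (relations.zsmul_mem eN' 2)) hmid) (relations.zsmul_mem eZ 2)) eQ

end Summit.KontsevichZagierPeriods.HurwitzMicroSectors.NormalFormPrinciple.PiBox.M3
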